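import Summits.CriticalPhenomena.PercolationContinuityZ3.Theorems.PercNearOneGluingNoHeavyLowerTailSwitchRelaxSemantics
import Summits.CriticalPhenomena.PercolationContinuityZ3.Theorems.PercNearOneGluingNoHeavyLowerTailSwitchingKSequential
import HarnessLib

/-!
# `NoHeavyLowerTail` (stmt-CriticalPhenomena-4575) — FOUR-copy switching certificates, I: the programs of the
# `X`-rooted pool (one or two sealed exploration steps of copy `0`, distinct target copies), their outputs, and
# preservation of `μ^{⊗4}`

Support file (prover prim-ineq-prove-3 gen 8; `--supports stmt-CriticalPhenomena-4575`).  No named facts, no sorries.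

The four-copy switching certificates of this unit (run/shared/lean/prim/prim-ineq-prove-3/THEOREM-*-4COPY.md; the `α` replay
of gen 8) use programs of the pool `X0`: explore the `X = x 0`-cluster of one marked terminal `τ u` and hand the pairs it
touches to a target copy `T₁ ≠ 0`; optionally explore the `X`-cluster of a second terminal `τ v` through the not-yet-used
pairs and hand that region to a second target `T₂ ∉ {0, T₁}`; the remaining copy is idle.  This is the case `k = 4`,
`r ≤ 2` of prim-masterthm-p1's sequential programs `SwitchingK.seqSplice` (`…SwitchingKSequential`), so measure
preservation is `SwitchingK.sum_wtKW_comp_seqSplice` once the two region maps are shown disjoint and determined forward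
(`GroupThreePointLB.selfDetermined_touch_clS`, `GroupThreePointLB.touch_clS_sdiff_congr`).  The outputs are written in the
`splice` form consumed by prim-cert-2's type-level output rules (`SwitchRelax.admClean_ftype`, `SwitchRelax.admMessy_ftype`):
* `Prog`, `Prog.reg`, `Prog.tgt`, `Prog.nsteps`, `Prog.out`, `Prog.wf`;
* `out_first`, `out_second`, `out_idle` — the target copies receive `X` on their regions, the idle copy is unchanged;
* **`sum_wtKW_out`** — every well-formed program preserves `μ^{⊗4}`.
-/

noncomputable section

namespace Summit.CriticalPhenomena.PercolationContinuityZ3.Theorems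

namespace FourCopyHub

open Finset Literature.Probability.Percolation Literature.Probability.Percolation.DecisionTree
open Literature.Probability.Percolation.Gladkov ThreePointLB GroupThreePointLB SwitchRelax SwitchingK
open scoped Classical

/-! ### Programs -/

/-- A program of the four-copy `X`-rooted pool: first root terminal `u` explored in copy `0` and exchanged with copy `T1`;
if `two`, second root terminal `v` explored through the unused pairs and exchanged with copy `T2`. [this work] -/
structure Prog where
  /-- two exploration steps? -/
  two : Bool
  /-- first root terminal -/
  u : Fin 4
  /-- first target copy -/
  T1 : Fin 4
  /-- second root terminal -/
  v : Fin 4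
  /-- second target copy -/
  T2 : Fin 4
deriving DecidableEq, Repr

namespace Prog

variable {V : Type*} [Fintype V] [DecidableEq V] (τ : Fin 4 → V)

/-- Number of exploration steps. [this work] -/
def nsteps (p : Prog) : ℕ := if p.two then 2 else 1

/-- Target copy of step `s`. [this work] -/
def tgt (p : Prog) (s : ℕ) : Fin 4 := if s = 0 then p.T1 else p.T2

/-- Region of step `s` read off copy `0`: the pairs touching the `K`-cluster of `τ u`; then the pairs touching the
`K`-cluster of `τ v` that were not used by the first step. [this work] -/
def reg (p : Prog) (s : ℕ) (K : Finset (Sym2 V)) : Finset (Sym2 V) :=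
  if s = 0 then touch (clS K (roots τ {p.u}))
  else if s = 1 then touch (clS K (roots τ {p.v})) \ touch (clS K (roots τ {p.u}))
  else ∅

/-- The output four-tuple of the program (`SwitchingK.seqSplice`). [this work] -/
def out (p : Prog) (x : Fin 4 → Finset (Sym2 V)) : Fin 4 → Finset (Sym2 V) :=
  seqSplice (p.reg τ) p.tgt p.nsteps x

/-- Well-formedness (Boolean): targets are not the source copy and are distinct. [this work] -/
def wf (p : Prog) : Bool := decide (p.T1 ≠ 0 ∧ (p.two = true → p.T2 ≠ 0 ∧ p.T2 ≠ p.T1))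

omit [Fintype V] [DecidableEq V] τ in
/-- `wf` unfolded. [this work] -/
theorem wf_iff (p : Prog) : p.wf = true ↔ p.T1 ≠ 0 ∧ (p.two = true → p.T2 ≠ 0 ∧ p.T2 ≠ p.T1) := by
  rw [wf, decide_eq_true_iff]

omit [Fintype V] [DecidableEq V] τ in
/-- Steps below `nsteps`. [this work] -/
theorem lt_nsteps_iff (p : Prog) (s : ℕ) : s < p.nsteps ↔ s = 0 ∨ (p.two = true ∧ s = 1) := by
  unfold nsteps
  cases p.two
  · simp
  · simp only [if_true, true_and]; omega

/-- The regions of one configuration are pairwise disjoint. [this work] -/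
theorem regionsDisjoint (p : Prog) : RegionsDisjoint (p.reg τ) p.nsteps := by
  intro K s s' hs hs' hne
  rw [lt_nsteps_iff] at hs hs'
  rcases hs with rfl | ⟨-, rfl⟩ <;> rcases hs' with rfl | ⟨-, rfl⟩
  · exact absurd rfl hne
  · simp only [reg, if_true, one_ne_zero, if_false]; exact Finset.disjoint_sdiff
  · simp only [reg, if_true, one_ne_zero, if_false]; exact Finset.sdiff_disjoint
  · exact absurd rfl hne

/-- The regions are determined forward (`selfDetermined_touch_clS`, `touch_clS_sdiff_congr`). [this work] -/
theorem regionsDetermined (p : Prog) : RegionsDetermined (p.reg τ) p.nsteps := by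
  intro s hs K K' h
  rw [lt_nsteps_iff] at hs
  rcases hs with rfl | ⟨-, rfl⟩
  · simp only [reg, if_true]
    refine selfDetermined_touch_clS (roots τ {p.u}) K K' fun i hi => h i ⟨0, le_rfl, ?_⟩
    simpa only [reg, if_true] using hi
  · simp only [reg, one_ne_zero, if_false, if_true]
    refine touch_clS_sdiff_congr (roots τ {p.u}) (roots τ {p.v}) K K' fun i hi => h i ?_
    rcases Finset.mem_union.1 hi with hi | hi
    · exact ⟨0, zero_le_one, by simpa only [reg, if_true] using hi⟩
    · exact ⟨1, le_rfl, by simpa only [reg, one_ne_zero, if_false, if_true] using hi⟩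

/-- The targets of a well-formed program are not copy `0`. [this work] -/
theorem tgt_ne_zero {p : Prog} (hp : p.wf = true) (s : ℕ) (hs : s < p.nsteps) : p.tgt s ≠ 0 := by
  rw [wf_iff] at hp
  rw [lt_nsteps_iff] at hs
  rcases hs with rfl | ⟨h2, rfl⟩
  · simpa [tgt] using hp.1
  · simpa [tgt] using (hp.2 h2).1

/-! ### Outputs -/

section Out

variable (x : Fin 4 → Finset (Sym2 V))

/-- The region received by copy `j`. [this work] -/
theorem mem_recv_iff (p : Prog) (j : Fin 4) (e : Sym2 V) :
    e ∈ recv (p.reg τ) p.tgt p.nsteps (x 0) j ↔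
      (p.T1 = j ∧ e ∈ touch (clS (x 0) (roots τ {p.u}))) ∨
      (p.two = true ∧ p.T2 = j ∧ e ∈ touch (clS (x 0) (roots τ {p.v})) \ touch (clS (x 0) (roots τ {p.u}))) := by
  rw [mem_recv]
  constructor
  · rintro ⟨s, hs, hT, he⟩
    rw [lt_nsteps_iff] at hs
    rcases hs with rfl | ⟨h2, rfl⟩
    · left; exact ⟨by simpa [tgt] using hT, by simpa [reg] using he⟩
    · right; exact ⟨h2, by simpa [tgt] using hT, by simpa [reg] using he⟩
  · rintro (⟨hT, he⟩ | ⟨h2, hT, he⟩)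
    · exact ⟨0, by simp [lt_nsteps_iff], by simpa [tgt] using hT, by simpa [reg] using he⟩
    · exact ⟨1, by simp [lt_nsteps_iff, h2], by simpa [tgt] using hT, by simpa [reg] using he⟩

/-- **First target**: `X` on the pairs touching the `X`-cluster of `τ u`, own bits elsewhere. [this work] -/
theorem out_first {p : Prog} (hp : p.wf = true) :
    p.out τ x p.T1 = splice (touch (clS (x 0) (roots τ {p.u}))) (x 0) (x p.T1) := by
  rw [wf_iff] at hp
  unfold out
  rw [seqSplice_ne_zero x hp.1]
  congr 1
  ext e
  rw [mem_recv_iff]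
  constructor
  · rintro (⟨-, he⟩ | ⟨h2, hT, -⟩)
    · exact he
    · exact absurd hT (hp.2 h2).2
  · intro he; exact Or.inl ⟨rfl, he⟩

/-- **Second target**: `X` on the pairs touching the `X`-cluster of `τ v` not used by the first step, own bits
elsewhere. [this work] -/
theorem out_second {p : Prog} (hp : p.wf = true) (h2 : p.two = true) :
    p.out τ x p.T2 = splice (touch (clS (x 0) (roots τ {p.v})) \ touch (clS (x 0) (roots τ {p.u}))) (x 0) (x p.T2) := by
  rw [wf_iff] at hp
  unfold out
  rw [seqSplice_ne_zero x (hp.2 h2).1]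
  congr 1
  ext e
  rw [mem_recv_iff]
  constructor
  · rintro (⟨hT, -⟩ | ⟨-, -, he⟩)
    · exact absurd hT.symm (hp.2 h2).2
    · exact he
  · intro he; exact Or.inr ⟨h2, rfl, he⟩

/-- **Idle copies** (`j ≠ 0` not a target) are unchanged. [this work] -/
theorem out_idle (p : Prog) {j : Fin 4} (hj : j ≠ 0) (h1 : p.T1 ≠ j) (h2 : p.two = true → p.T2 ≠ j) :
    p.out τ x j = x j := by
  unfold out
  rw [seqSplice_ne_zero x hj]
  have hr : recv (p.reg τ) p.tgt p.nsteps (x 0) j = ∅ := by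
    ext e
    rw [mem_recv_iff]
    simp only [Finset.notMem_empty, iff_false, not_or, not_and]
    exact ⟨fun h => absurd h h1, fun ht hT => absurd hT (h2 ht)⟩
  rw [hr, splice_empty]

/-- For a one-step program the copies other than `0` and `T1` are unchanged. [this work] -/
theorem out_of_one {p : Prog} (h : p.two = false) {j : Fin 4} (hj : j ≠ 0) (h1 : p.T1 ≠ j) : p.out τ x j = x j :=
  out_idle τ x p hj h1 (fun h2 => by rw [h] at h2; exact absurd h2 (by decide))

end Out

/-! ### Measure preservation -/

/-- **Every well-formed program preserves `μ^{⊗4}`**: `Σ_x wtKW x · f (p.out x) = Σ_x wtKW x · f x`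
(`SwitchingK.sum_wtKW_comp_seqSplice`, k = 4). [cite: GladkovZimin2024, Lemma 4.2 and proof of Thm. 4.6; four-copy form] -/
theorem sum_wtKW_out {p : Prog} (hp : p.wf = true) (prob : Sym2 V → ℝ) (D : Finset (Sym2 V))
    (f : (Fin 4 → Finset (Sym2 V)) → ℝ) :
    ∑ x ∈ tuplesK D 4, wtKW D prob x * f (p.out τ x) = ∑ x ∈ tuplesK D 4, wtKW D prob x * f x :=
  sum_wtKW_comp_seqSplice prob (p.regionsDisjoint τ) (p.regionsDetermined τ) (fun s hs => tgt_ne_zero hp s hs) D f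

end Prog

end FourCopyHub

end Summit.CriticalPhenomena.PercolationContinuityZ3.Theorems

end
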